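import Literature.Probability.Percolation.VoronoiArmEstimates
import Literature.Probability.Percolation.AnnulusSubcontinuum
import Literature.Topology.PlaneTopology.RectangleDuality
import Literature.Analysis.FunctionSpaces.PoissonRestrictionIndependence
import Literature.Analysis.FunctionSpaces.PoissonMecke
import Mathlib.MeasureTheory.Measure.Lebesgue.VolumeOfBalls
import Mathlib.Analysis.SpecialFunctions.Log.Base
import HarnessLib

/-!
# Towards Tassion's one-arm estimate: strict arms, locality and the multi-scale argument

Topic: Probability / Percolation.  Proofs file for `VoronoiArmEstimates.lean` (named fact
`VoronoiAnnealedOneArm`, Tassion 2016 Thm 3 (2)).  This file formalises the part of the printed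
proof that is specific to Theorem 3 (2) — the "standard circuit argument" of §4 together with the
locality Lemma 1.1 — for the **strictly black** region, in the tree's vocabulary
(`PointConfig ℂ × PointConfig ℂ` under `PB.prod PW`, `blackRegion`):

* `strictBlackRegion B W = {z | infDist z B < infDist z W}` — the points strictly closer to a black
  nucleus (open; its complement is the weak white region `blackRegion W B`).
* measurability, for the count σ-algebra, of `c ↦ infDist w c`, of "a compact set is strictly
  black", and of the strict connection events `{ω | ∃ a ∈ P₁, ∃ b ∈ P₂, JoinedIn (S ω) a b}` for open
  `P₁, P₂` (chains of rational closed balls inside the open set `S ω`);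
* the locality event `nucleiNear z u` (every point of the annulus `u ≤ |w - z| ≤ 4u` has a black
  AND a white nucleus within `u/4`; a finite intersection of count events of balls inside the open
  annulus `u/2 < |w - z| < 9u/2`), its void-probability bound, and the identity of the strict
  region inside the annulus with that of the configuration restricted to `u/2 < |w - z| < 9u/2`
  (Tassion 2016, Lemma 1.1);
* independence of the pairs of restrictions to disjoint regions under `PB.prod PW`
  (Kingman's restriction theorem, both colours);
* `strictOneArm_decay_of_annulusBound` — **Tassion §4**: a scale-uniform bound `1 - c` on the
  probability of a strictly black crossing of the annuli `{u < |w - z| < 4u}`, `u ≥ u₀`, gives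
  `C (s/t)^η` for the probability of a strictly black path from `B(z, s)` to `{|w - z| > t}`,
  `1 ≤ s ≤ t`, via the independent scales `u = 9^i s`.

Nothing here is a named fact; the RSW input (Tassion Thm 1) is a HYPOTHESIS of the last theorem.

## References
* V. Tassion, *Crossing probabilities for Voronoi percolation*, Ann. Probab. 44 (2016)
  3385–3398, arXiv:1410.6773 — Lemma 1.1, §4 (proof of Thm 3 (2)). [Tassion2016]
* J. F. C. Kingman, *Poisson Processes* (1993), §2.2 (restriction theorem). [Kingman1993]
-/

noncomputable section

namespace Literature.Probability.Percolation

open _root_.MeasureTheory _root_.ProbabilityTheory _root_.Filter _root_.Set _root_.Metric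
open scoped _root_.Topology _root_.ENNReal _root_.NNReal
open Literature.Analysis.FunctionSpaces
open Literature.Topology.PlaneTopology

/-! ### The strictly black region -/

/-- **The strictly black region** of the nucleus sets `B`, `W`: the points strictly closer to `B`
than to `W` (interior points of black cells, away from bichromatic faces).  Its complement is the
weak white region `blackRegion W B` (Tassion 2016, §1.1: boundary points "are both black and
white"). [cite: Tassion2016, §1.1] -/
def strictBlackRegion (B W : Set ℂ) : Set ℂ :=
  {z | infDist z B < infDist z W}

variable {B W : Set ℂ} {z : ℂ}

/-- Unfolding lemma for `strictBlackRegion`. [cite: Tassion2016, §1.1] -/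
@[simp] theorem mem_strictBlackRegion : z ∈ strictBlackRegion B W ↔ infDist z B < infDist z W :=
  Iff.rfl

/-- The strictly black region is open. [folklore] -/
theorem isOpen_strictBlackRegion (B W : Set ℂ) : IsOpen (strictBlackRegion B W) :=
  isOpen_lt (continuous_infDist_pt B) (continuous_infDist_pt W)

/-- Strictly black points are black. [folklore] -/
theorem strictBlackRegion_subset_blackRegion (B W : Set ℂ) :
    strictBlackRegion B W ⊆ blackRegion B W :=
  fun x (hx : infDist x B < infDist x W) => show infDist x B ≤ infDist x W from hx.le

/-- The complement of the strictly black region is the (weak) white region. [cite: Tassion2016, §1.1] -/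
theorem compl_strictBlackRegion (B W : Set ℂ) : (strictBlackRegion B W)ᶜ = blackRegion W B := by
  ext w; simp [not_lt]

/-! ### Measurability of distances to a configuration -/

section Measurability

variable {E : Type*} [PseudoMetricSpace E] [MeasurableSpace E] [OpensMeasurableSpace E]

/-- `N(s) ≠ 0` iff the configuration has a point in `s`. [folklore] -/
theorem _root_.Literature.Analysis.FunctionSpaces.PointConfig.count_ne_zero_iff
    {F : Type*} [TopologicalSpace F] (c : PointConfig F) (s : Set F) :
    c.count s ≠ 0 ↔ (c.carrier ∩ s).Nonempty :=
  Set.encard_ne_zero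

/-- `N(s) = 0` iff the configuration has no point in `s`. [folklore] -/
theorem _root_.Literature.Analysis.FunctionSpaces.PointConfig.count_eq_zero_iff'
    {F : Type*} [TopologicalSpace F] (c : PointConfig F) (s : Set F) :
    c.count s = 0 ↔ c.carrier ∩ s = ∅ :=
  Set.encard_eq_zero

omit [MeasurableSpace E] [OpensMeasurableSpace E] in
/-- For a configuration `c` and a point `w`, `infDist w c < r` iff either `c` has a point in the
open ball `ball w r`, or `c` is empty and `0 < r` (junk value `infDist w ∅ = 0`). [folklore] -/
theorem _root_.Literature.Analysis.FunctionSpaces.PointConfig.infDist_coe_lt_iff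
    (c : PointConfig E) (w : E) (r : ℝ) :
    infDist w (c : Set E) < r ↔ c.count (ball w r) ≠ 0 ∨ (c.count univ = 0 ∧ 0 < r) := by
  rw [PointConfig.count_ne_zero_iff, PointConfig.count_eq_zero_iff', Set.inter_univ,
    PointConfig.coe_eq_carrier]
  rcases c.carrier.eq_empty_or_nonempty with hc | hc
  · simp [hc]
  · rw [infDist_lt_iff hc]
    have hne : c.carrier ≠ ∅ := hc.ne_empty
    simp only [hne, false_and, or_false]
    constructor
    · rintro ⟨y, hy, hyr⟩
      exact ⟨y, hy, by simpa [mem_ball, dist_comm] using hyr⟩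
    · rintro ⟨y, hy, hyr⟩
      exact ⟨y, hy, by simpa [mem_ball, dist_comm] using hyr⟩

/-- **`c ↦ infDist w c` is measurable** for the count σ-algebra on configurations: its sub-level
sets are count events of balls. [folklore] -/
theorem _root_.Literature.Analysis.FunctionSpaces.PointConfig.measurable_infDist_coe (w : E) :
    Measurable fun c : PointConfig E => infDist w (c : Set E) := by
  refine measurable_of_Iio fun r => ?_
  have hset : (fun c : PointConfig E => infDist w (c : Set E)) ⁻¹' Iio r =
      {c | c.count (ball w r) ≠ 0} ∪ ({c | c.count univ = 0} ∩ {_c | 0 < r}) := by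
    ext c
    simp only [mem_preimage, mem_Iio, mem_union, mem_inter_iff, mem_setOf_eq]
    exact c.infDist_coe_lt_iff w r
  rw [hset]
  refine MeasurableSet.union ?_ (MeasurableSet.inter ?_ (MeasurableSet.const _))
  · exact (PointConfig.measurable_count measurableSet_ball)
      (MeasurableSpace.measurableSet_top : MeasurableSet {x : ℕ∞ | x ≠ 0})
  · exact (PointConfig.measurable_count MeasurableSet.univ)
      (MeasurableSpace.measurableSet_top : MeasurableSet {x : ℕ∞ | x = 0})

end Measurability

/-! ### Events quantified over a set of points; strictly black compact sets -/

section ForallEvents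

variable {α : Type*} [MeasurableSpace α]

/-- **Events "`h(·, w) ≤ 0` for all `w ∈ Q`" are measurable** when `h` is measurable in the first
variable and uniformly Lipschitz in `w`: by density of a countable set `D ⊆ ℂ`, the event equals
`⋂_{q ∈ D} {h(·, q) ≤ K · infDist q Q}` (no countable dense subset of `Q` itself is needed).
[folklore] -/
theorem measurableSet_forall_mem_le {h : α → ℂ → ℝ} {K : ℝ≥0} (hK : ∀ a, LipschitzWith K (h a))
    (hm : ∀ w, Measurable fun a => h a w) (Q : Set ℂ) :
    MeasurableSet {a | ∀ w ∈ Q, h a w ≤ 0} := by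
  rcases Q.eq_empty_or_nonempty with rfl | hQ
  · simp
  set q : ℕ → ℂ := TopologicalSpace.denseSeq ℂ with hq
  have hqd : DenseRange q := TopologicalSpace.denseRange_denseSeq ℂ
  have key : {a | ∀ w ∈ Q, h a w ≤ 0} = ⋂ n : ℕ, {a | h a (q n) ≤ K * infDist (q n) Q} := by
    ext a
    simp only [mem_setOf_eq, mem_iInter]
    constructor
    · intro ha n
      haveI : Nonempty Q := hQ.to_subtype
      rw [infDist_eq_iInf, Real.mul_iInf_of_nonneg K.coe_nonneg]
      refine le_ciInf fun w => ?_
      have h1 := (hK a).dist_le_mul (q n) w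
      rw [Real.dist_eq] at h1
      have h2 := ha w w.2
      have h3 := (abs_le.1 h1).2
      linarith
    · intro ha w hw
      refine le_of_forall_pos_le_add fun ε hε => ?_
      have hK0 : 0 ≤ (K : ℝ) := K.coe_nonneg
      obtain ⟨n, hn⟩ : ∃ n, dist w (q n) < ε / (2 * K + 1) :=
        Metric.denseRange_iff.1 hqd w _ (by positivity)
      have h1 := (hK a).dist_le_mul w (q n)
      rw [Real.dist_eq] at h1
      have h3 := (abs_le.1 h1).2
      have h4 : infDist (q n) Q ≤ dist (q n) w := infDist_le_dist_of_mem hw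
      rw [dist_comm] at h4
      have h5 := ha n
      have h6 : (K : ℝ) * infDist (q n) Q ≤ K * dist w (q n) := mul_le_mul_of_nonneg_left h4 hK0
      have h7 : (2 * K + 1) * dist w (q n) < ε := by
        rwa [lt_div_iff₀ (by positivity), mul_comm] at hn
      nlinarith [dist_nonneg (x := w) (y := q n)]
  rw [key]
  exact MeasurableSet.iInter fun n => measurableSet_le (hm _) measurable_const

/-- **Events "`h(·, w) < 0` for all `w` in a compact `Q`" are measurable** (`h` measurable in the
first variable, uniformly Lipschitz in `w`): on a compact set a continuous negative function is
bounded away from `0`, so the event is `⋃ₘ {∀ w ∈ Q, h(·, w) + 1/(m+1) ≤ 0}`. [folklore] -/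
theorem measurableSet_forall_mem_lt {h : α → ℂ → ℝ} {K : ℝ≥0} (hK : ∀ a, LipschitzWith K (h a))
    (hm : ∀ w, Measurable fun a => h a w) {Q : Set ℂ} (hQ : IsCompact Q) :
    MeasurableSet {a | ∀ w ∈ Q, h a w < 0} := by
  rcases Q.eq_empty_or_nonempty with rfl | hQne
  · simp
  have key : {a | ∀ w ∈ Q, h a w < 0} =
      ⋃ m : ℕ, {a | ∀ w ∈ Q, h a w + 1 / ((m : ℝ) + 1) ≤ 0} := by
    ext a
    simp only [mem_setOf_eq, mem_iUnion]
    constructor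
    · intro ha
      obtain ⟨w₀, hw₀, hmin⟩ :=
        hQ.exists_isMinOn hQne ((hK a).continuous.neg.continuousOn)
      have hpos : 0 < -h a w₀ := by linarith [ha w₀ hw₀]
      obtain ⟨m, hm⟩ := exists_nat_one_div_lt hpos
      refine ⟨m, fun w hw => ?_⟩
      have := hmin hw
      simp only [mem_setOf_eq, Pi.neg_apply] at this
      linarith
    · rintro ⟨m, hmw⟩ w hw
      have := hmw w hw
      have hpos : (0 : ℝ) < 1 / ((m : ℝ) + 1) := Nat.one_div_pos_of_nat
      linarith
  rw [key]
  refine MeasurableSet.iUnion fun m => ?_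
  exact measurableSet_forall_mem_le (K := K + 0) (fun a => (hK a).add (LipschitzWith.const _))
    (fun w => (hm w).add_const _) Q

end ForallEvents

/-- The configuration-pair space of two-coloured nuclei. -/
local notation "Ω₂" => PointConfig ℂ × PointConfig ℂ

/-- The strictly black region of a pair of configurations (black nuclei `ω.1`, white `ω.2`). -/
local notation "𝐒" ω => strictBlackRegion ((Prod.fst ω : PointConfig ℂ) : Set ℂ)
  ((Prod.snd ω : PointConfig ℂ) : Set ℂ)

/-- **"The compact set `Q` is strictly black" is measurable** on `PointConfig ℂ × PointConfig ℂ`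
(count σ-algebras): `w ↦ infDist w B - infDist w W` is `2`-Lipschitz and measurable in the
configuration. [folklore] -/
theorem measurableSet_subset_strictBlackRegion {Q : Set ℂ} (hQ : IsCompact Q) :
    MeasurableSet {ω : Ω₂ | Q ⊆ 𝐒 ω} := by
  have h := measurableSet_forall_mem_lt (α := Ω₂) (K := 1 + 1) (Q := Q)
    (h := fun ω w => infDist w ((ω.1 : PointConfig ℂ) : Set ℂ) - infDist w ((ω.2 : PointConfig ℂ) : Set ℂ))
    (fun ω => (lipschitz_infDist_pt _).sub (lipschitz_infDist_pt _))
    (fun w => ((PointConfig.measurable_infDist_coe w).comp measurable_fst).sub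
      ((PointConfig.measurable_infDist_coe w).comp measurable_snd)) hQ
  convert h using 2 with ω
  simp only [subset_def, mem_strictBlackRegion, sub_neg]


/-! ### Strict connection events are measurable: chains of rational balls -/

section BallChains

variable {α : Type*} [MeasurableSpace α]

/-- The point of `ℂ` with rational coordinates `q`. [folklore] -/
def ratPt (q : ℚ × ℚ) : ℂ := ⟨q.1, q.2⟩

/-- Points with rational coordinates are dense in `ℂ`. [folklore] -/
theorem exists_dist_ratPt_lt (z : ℂ) {ε : ℝ} (hε : 0 < ε) : ∃ q : ℚ × ℚ, dist (ratPt q) z < ε := by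
  obtain ⟨q₁, hq₁⟩ := exists_rat_near z.re (half_pos hε)
  obtain ⟨q₂, hq₂⟩ := exists_rat_near z.im (half_pos hε)
  refine ⟨(q₁, q₂), ?_⟩
  rw [dist_comm]
  calc dist z (ratPt (q₁, q₂)) = ‖z - ratPt (q₁, q₂)‖ := dist_eq_norm _ _
    _ ≤ |(z - ratPt (q₁, q₂)).re| + |(z - ratPt (q₁, q₂)).im| := Complex.norm_le_abs_re_add_abs_im _
    _ = |z.re - q₁| + |z.im - q₂| := by simp [ratPt]
    _ < ε := by linarith

/-- The `j`-th of the `n + 1` equally spaced sample times `j / n` of `[0, 1]` (`n ≥ 1`). [folklore] -/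
def sampleTime (n : ℕ) (j : Fin (n + 1)) : unitInterval :=
  ⟨(j : ℝ) / n, by
    rcases Nat.eq_zero_or_pos n with rfl | hn
    · simp
    · exact ⟨by positivity, by
        rw [div_le_one (by exact_mod_cast hn)]; exact_mod_cast Nat.lt_succ_iff.1 j.2⟩⟩

/-- Value of a sample time. [folklore] -/
@[simp] theorem coe_sampleTime (n : ℕ) (j : Fin (n + 1)) : (sampleTime n j : ℝ) = (j : ℝ) / n := rfl

/-- The first sample time is `0`. [folklore] -/
theorem sampleTime_zero (n : ℕ) : sampleTime n 0 = 0 := Subtype.ext (by simp)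

/-- The last sample time is `1`. [folklore] -/
theorem sampleTime_last {n : ℕ} (hn : 0 < n) : sampleTime n (Fin.last n) = 1 :=
  Subtype.ext (by simp [hn.ne'])

/-- Consecutive sample times are `1/n` apart. [folklore] -/
theorem dist_sampleTime_succ {n : ℕ} (hn : 0 < n) (j : Fin n) :
    dist (sampleTime n j.castSucc) (sampleTime n j.succ) = 1 / n := by
  rw [Subtype.dist_eq, coe_sampleTime, coe_sampleTime, Real.dist_eq, Fin.val_castSucc, Fin.val_succ]
  have hn' : (0 : ℝ) < n := by exact_mod_cast hn
  rw [show ((j : ℕ) : ℝ) / n - (((j : ℕ) + 1 : ℕ) : ℝ) / n = -(1 / n) by push_cast; ring]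
  rw [abs_neg, abs_of_pos (by positivity)]

/-- A **chain of closed balls** of radius `r` centred at the rational points `c 0, …, c n`:
positive radius, consecutive centres at distance `≤ 2r` (so consecutive balls share their
midpoint), all balls inside `U`, first centre in `P₁`, last centre in `P₂`. [folklore] -/
def IsBallChain (U P₁ P₂ : Set ℂ) (n : ℕ) (c : Fin (n + 1) → ℚ × ℚ) (r : ℚ) : Prop :=
  0 < (r : ℝ) ∧ ratPt (c 0) ∈ P₁ ∧ ratPt (c (Fin.last n)) ∈ P₂ ∧
    (∀ j : Fin n, dist (ratPt (c j.castSucc)) (ratPt (c j.succ)) ≤ 2 * r) ∧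
    ∀ j, closedBall (ratPt (c j)) r ⊆ U

/-- A ball chain inside `U` joins its first and last centres inside `U`. [folklore] -/
theorem IsBallChain.joinedIn {U P₁ P₂ : Set ℂ} {n : ℕ} {c : Fin (n + 1) → ℚ × ℚ} {r : ℚ}
    (h : IsBallChain U P₁ P₂ n c r) : JoinedIn U (ratPt (c 0)) (ratPt (c (Fin.last n))) := by
  obtain ⟨hr, -, -, hdist, hsub⟩ := h
  -- join `c 0` to `c k` for every `k ≤ n`, by induction on `k`
  suffices H : ∀ k (hk : k < n + 1), JoinedIn U (ratPt (c 0)) (ratPt (c ⟨k, hk⟩)) from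
    H n (Nat.lt_succ_self n)
  intro k hk
  induction k with
  | zero =>
    exact JoinedIn.refl (hsub 0 (mem_closedBall_self hr.le))
  | succ k ih =>
    have hk' : k < n := Nat.lt_of_succ_lt_succ hk
    refine (ih (Nat.lt_of_succ_lt hk)).trans ?_
    -- consecutive balls: through the midpoint
    set x := ratPt (c ⟨k, Nat.lt_of_succ_lt hk⟩) with hx
    set y := ratPt (c ⟨k + 1, hk⟩) with hy
    have hxy : dist x y ≤ 2 * r := by
      have := hdist ⟨k, hk'⟩
      simpa [Fin.castSucc_mk, Fin.succ_mk] using this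
    set m : ℂ := midpoint ℝ x y with hm
    have hmx : m ∈ closedBall x r := by
      rw [mem_closedBall, dist_comm, hm, dist_left_midpoint, Real.norm_of_nonneg (by norm_num)]
      linarith
    have hmy : m ∈ closedBall y r := by
      rw [mem_closedBall, dist_comm, hm, dist_right_midpoint, Real.norm_of_nonneg (by norm_num)]
      linarith
    have hbx := hsub ⟨k, Nat.lt_of_succ_lt hk⟩
    have hby := hsub ⟨k + 1, hk⟩
    have h1 : JoinedIn U x m :=
      (((convex_closedBall x (r : ℝ)).isPathConnected ⟨x, mem_closedBall_self hr.le⟩).joinedIn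
        x (mem_closedBall_self hr.le) m hmx).mono hbx
    have h2 : JoinedIn U m y :=
      (((convex_closedBall y (r : ℝ)).isPathConnected ⟨y, mem_closedBall_self hr.le⟩).joinedIn
        m hmy y (mem_closedBall_self hr.le)).mono hby
    exact h1.trans h2

/-- **A path in an open set runs through a chain of rational balls**: if `x ∈ P₁`, `y ∈ P₂`
(`P₁`, `P₂` open) are joined in the open set `U ⊆ ℂ`, there is a ball chain for `(U, P₁, P₂)`
(uniform continuity of the path, a tube `cthickening ε (range γ) ⊆ U`, rational approximation).
[folklore] -/
theorem exists_isBallChain_of_joinedIn {U P₁ P₂ : Set ℂ} (hU : IsOpen U) (hP₁ : IsOpen P₁)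
    (hP₂ : IsOpen P₂) {x y : ℂ} (hx : x ∈ P₁) (hy : y ∈ P₂) (hJ : JoinedIn U x y) :
    ∃ (n : ℕ) (c : Fin (n + 1) → ℚ × ℚ) (r : ℚ), IsBallChain U P₁ P₂ n c r := by
  obtain ⟨γ, hγ⟩ : ∃ γ : Path x y, ∀ t, γ t ∈ U := ⟨hJ.somePath, hJ.somePath_mem⟩
  have hK : IsCompact (range γ) := isCompact_range γ.continuous
  obtain ⟨ε₀, hε₀, hthick⟩ := hK.exists_cthickening_subset_open hU (range_subset_iff.2 hγ)
  obtain ⟨ε₁, hε₁, hball₁⟩ := Metric.isOpen_iff.1 hP₁ x hx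
  obtain ⟨ε₂, hε₂, hball₂⟩ := Metric.isOpen_iff.1 hP₂ y hy
  set ε : ℝ := min ε₀ (min ε₁ ε₂) / 4 with hεdef
  have hε : 0 < ε := by positivity
  have hεε₀ : 4 * ε ≤ ε₀ := by
    rw [hεdef]; linarith [min_le_left ε₀ (min ε₁ ε₂)]
  have hεε₁ : ε < ε₁ := by
    rw [hεdef]; linarith [min_le_right ε₀ (min ε₁ ε₂), min_le_left ε₁ ε₂]
  have hεε₂ : ε < ε₂ := by
    rw [hεdef]; linarith [min_le_right ε₀ (min ε₁ ε₂), min_le_right ε₁ ε₂]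
  -- uniform continuity of `γ`
  obtain ⟨δ, hδ, hunif⟩ := Metric.uniformContinuous_iff.1
    (CompactSpace.uniformContinuous_of_continuous γ.continuous) ε hε
  obtain ⟨n₀, hn₀⟩ := exists_nat_one_div_lt hδ
  set n : ℕ := n₀ + 1 with hn
  have hnpos : 0 < n := Nat.succ_pos _
  have hstep : ∀ j : Fin n, dist (γ (sampleTime n j.castSucc)) (γ (sampleTime n j.succ)) < ε :=
    fun j => hunif (by rw [dist_sampleTime_succ hnpos]; exact_mod_cast hn₀)
  -- rational approximations of the sample points, and a rational radius
  choose c hc using fun j : Fin (n + 1) => exists_dist_ratPt_lt (γ (sampleTime n j)) hε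
  obtain ⟨r, hr₁, hr₂⟩ := exists_rat_btwn (show 2 * ε < 3 * ε by linarith)
  refine ⟨n, c, r, ?_, ?_, ?_, ?_, ?_⟩
  · exact_mod_cast (show (0 : ℝ) < r by linarith)
  · apply hball₁
    rw [mem_ball]
    have := hc 0
    rw [sampleTime_zero, γ.source] at this
    exact this.trans hεε₁
  · apply hball₂
    rw [mem_ball]
    have := hc (Fin.last n)
    rw [sampleTime_last hnpos, γ.target] at this
    exact this.trans hεε₂
  · intro j
    have h1 := hc j.castSucc
    have h2 := hc j.succ
    have h3 := hstep j
    rw [dist_comm] at h2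
    calc dist (ratPt (c j.castSucc)) (ratPt (c j.succ))
        ≤ dist (ratPt (c j.castSucc)) (γ (sampleTime n j.castSucc)) +
          dist (γ (sampleTime n j.castSucc)) (γ (sampleTime n j.succ)) +
          dist (γ (sampleTime n j.succ)) (ratPt (c j.succ)) := dist_triangle4 _ _ _ _
      _ ≤ 2 * r := by linarith
  · intro j w hw
    apply hthick
    rw [mem_closedBall] at hw
    refine mem_cthickening_of_dist_le w (γ (sampleTime n j)) ε₀ _ (mem_range_self _) ?_
    have := hc j
    calc dist w (γ (sampleTime n j)) ≤ dist w (ratPt (c j)) + dist (ratPt (c j)) (γ (sampleTime n j)) :=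
          dist_triangle _ _ _
      _ ≤ ε₀ := by linarith

/-- **Strict connection events are measurable.**  Let `U a ⊆ ℂ` be open for every `a`, with
`{a | closedBall q r ⊆ U a}` measurable for all `q`, `r`; then for open `P₁`, `P₂` the event
"some point of `P₁` is joined to some point of `P₂` inside `U a`" is measurable: it is the
countable union over rational ball chains of the events "every ball of the chain lies in `U a`".
[folklore] -/
theorem measurableSet_exists_joinedIn {U : α → Set ℂ} (hU : ∀ a, IsOpen (U a))
    (hmeas : ∀ (q : ℂ) (r : ℝ), MeasurableSet {a | closedBall q r ⊆ U a}) {P₁ P₂ : Set ℂ}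
    (hP₁ : IsOpen P₁) (hP₂ : IsOpen P₂) :
    MeasurableSet {a | ∃ x ∈ P₁, ∃ y ∈ P₂, JoinedIn (U a) x y} := by
  have key : {a | ∃ x ∈ P₁, ∃ y ∈ P₂, JoinedIn (U a) x y} =
      ⋃ (n : ℕ) (c : Fin (n + 1) → ℚ × ℚ) (r : ℚ), {a | IsBallChain (U a) P₁ P₂ n c r} := by
    ext a
    simp only [mem_setOf_eq, mem_iUnion]
    constructor
    · rintro ⟨x, hx, y, hy, hJ⟩
      exact exists_isBallChain_of_joinedIn (hU a) hP₁ hP₂ hx hy hJ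
    · rintro ⟨n, c, r, h⟩
      exact ⟨_, h.2.1, _, h.2.2.1, h.joinedIn⟩
  rw [key]
  refine MeasurableSet.iUnion fun n => MeasurableSet.iUnion fun c => MeasurableSet.iUnion fun r => ?_
  have hset : {a | IsBallChain (U a) P₁ P₂ n c r} =
      {_a | 0 < (r : ℝ) ∧ ratPt (c 0) ∈ P₁ ∧ ratPt (c (Fin.last n)) ∈ P₂ ∧
        ∀ j : Fin n, dist (ratPt (c j.castSucc)) (ratPt (c j.succ)) ≤ 2 * r} ∩
      ⋂ j, {a | closedBall (ratPt (c j)) r ⊆ U a} := by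
    ext a
    simp only [IsBallChain, mem_setOf_eq, mem_inter_iff, mem_iInter, and_assoc]
  rw [hset]
  exact (MeasurableSet.const _).inter (MeasurableSet.iInter fun j => hmeas _ _)

end BallChains

/-! ### The events: strict arms, strict annulus crossings, nuclei near every point -/

section Events

/-- **Strict one-arm event** `strictArm z s t`: some point of the open disc `|a - z| < s` is joined
to some point with `|b - z| > t` by a path of STRICTLY black points (Tassion's `π₁(s, t)` event,
round version, strict colour). [cite: Tassion2016, Thm 3 (2)] -/
def strictArm (z : ℂ) (s t : ℝ) : Set Ω₂ :=
  {ω | ∃ a ∈ ball z s, ∃ b ∈ (closedBall z t)ᶜ, JoinedIn (𝐒 ω) a b}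

/-- **Strict annulus crossing at scale `u`** around `z`: a strictly black path inside the open
annulus `u < |w - z| < 4u` from a point with `|a - z| < 5u/4` to a point with `|b - z| > 15u/4`
(the event whose probability RSW theory bounds away from `1`; cf. Tassion 2016 §4, "there exists
a black circuit in `A_{s,t}`" by duality). [cite: Tassion2016, §4] -/
def strictAnnulusCrossing (z : ℂ) (u : ℝ) : Set Ω₂ :=
  {ω | ∃ a ∈ ball z (5 / 4 * u), ∃ b ∈ (closedBall z (15 / 4 * u))ᶜ,
    JoinedIn ((𝐒 ω) ∩ (ball z (4 * u) \ closedBall z u)) a b}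

/-- The point of `ℂ` with integer coordinates `p`. [folklore] -/
def intPt (p : ℤ × ℤ) : ℂ := ⟨p.1, p.2⟩

/-- The grid indices of the locality event: Gaussian integers `p` with `5 < |p| < 35`
(`25 < |p|² < 1225`); a finite set (`finite_setOf_isGridIndex`). [folklore] -/
def IsGridIndex (p : ℤ × ℤ) : Prop := 25 < p.1 ^ 2 + p.2 ^ 2 ∧ p.1 ^ 2 + p.2 ^ 2 < 1225

/-- There are finitely many grid indices (all inside `[-35, 35]²`). [folklore] -/
theorem finite_setOf_isGridIndex : {p : ℤ × ℤ | IsGridIndex p}.Finite := by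
  refine ((Set.finite_Icc (-35 : ℤ) 35).prod (Set.finite_Icc (-35 : ℤ) 35)).subset ?_
  rintro p ⟨-, h2⟩
  have h1' : p.1 ^ 2 < 35 ^ 2 := by nlinarith [sq_nonneg p.2]
  have h2' : p.2 ^ 2 < 35 ^ 2 := by nlinarith [sq_nonneg p.1]
  have ha := abs_lt.1 (abs_lt_of_sq_lt_sq h1' (by norm_num))
  have hb := abs_lt.1 (abs_lt_of_sq_lt_sq h2' (by norm_num))
  exact ⟨⟨ha.1.le, ha.2.le⟩, ⟨hb.1.le, hb.2.le⟩⟩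

/-- The grid point `z + (u/8) p` of the locality event. [folklore] -/
def gridPt (z : ℂ) (u : ℝ) (p : ℤ × ℤ) : ℂ := z + ((u / 8 : ℝ) : ℂ) * intPt p

/-- **Locality event** `nucleiNear z u` (Tassion's `𝓕_s`, two-colour form): every ball of radius
`u/8` centred at a grid point `z + (u/8)p`, `5 < |p| < 35`, contains a black AND a white nucleus.
On this event every point `w` with `u ≤ |w - z| ≤ 4u` has nuclei of both colours within `u/4`,
so its colour is decided by the nuclei in `u/2 < |x - z| < 9u/2`. [cite: Tassion2016, Lemma 1.1] -/
def nucleiNear (z : ℂ) (u : ℝ) : Set Ω₂ :=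
  {ω | ∀ p, IsGridIndex p → (ω.1 : PointConfig ℂ).count (ball (gridPt z u p) (u / 8)) ≠ 0 ∧
    (ω.2 : PointConfig ℂ).count (ball (gridPt z u p) (u / 8)) ≠ 0}

/-- The region `u/2 < |x - z| < 9u/2` carrying the nuclei that decide the scale-`u` events. [folklore] -/
def localityRegion (z : ℂ) (u : ℝ) : Set ℂ := ball z (9 / 2 * u) \ closedBall z (u / 2)

/-- Restriction of both colours to a region. [folklore] -/
def restrictPair (D : Set ℂ) (ω : Ω₂) : Ω₂ :=
  ((ω.1 : PointConfig ℂ).restrict D, (ω.2 : PointConfig ℂ).restrict D)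

/-- The locality region is measurable. [folklore] -/
theorem measurableSet_localityRegion (z : ℂ) (u : ℝ) : MeasurableSet (localityRegion z u) :=
  measurableSet_ball.diff measurableSet_closedBall

/-- Restricting both colours to a measurable region is measurable. [folklore] -/
theorem measurable_restrictPair {D : Set ℂ} (hD : MeasurableSet D) : Measurable (restrictPair D) :=
  ((PointConfig.measurable_restrict hD).comp measurable_fst).prodMk
    ((PointConfig.measurable_restrict hD).comp measurable_snd)

/-- The points of a restricted configuration. [folklore] -/
@[simp] theorem coe_restrict (c : PointConfig ℂ) (D : Set ℂ) :
    ((PointConfig.restrict D c : PointConfig ℂ) : Set ℂ) = (c : Set ℂ) ∩ D := rfl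

/-! #### Measurability of the events -/

/-- "A closed ball lies in the strict region and in a fixed set `O`" is measurable. [folklore] -/
theorem measurableSet_closedBall_subset_strict_inter (q : ℂ) (r : ℝ) (O : Set ℂ) :
    MeasurableSet {ω : Ω₂ | closedBall q r ⊆ (𝐒 ω) ∩ O} := by
  have : {ω : Ω₂ | closedBall q r ⊆ (𝐒 ω) ∩ O} =
      {ω : Ω₂ | closedBall q r ⊆ 𝐒 ω} ∩ {_ω | closedBall q r ⊆ O} := by
    ext ω; simp only [subset_inter_iff, mem_setOf_eq, mem_inter_iff]
  rw [this]
  exact (measurableSet_subset_strictBlackRegion (isCompact_closedBall q r)).inter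
    (MeasurableSet.const _)

/-- The strict arm event is measurable. [folklore] -/
theorem measurableSet_strictArm (z : ℂ) (s t : ℝ) : MeasurableSet (strictArm z s t) :=
  measurableSet_exists_joinedIn (U := fun ω : Ω₂ => 𝐒 ω) (fun _ => isOpen_strictBlackRegion _ _)
    (fun q r => measurableSet_subset_strictBlackRegion (isCompact_closedBall q r)) isOpen_ball
    isClosed_closedBall.isOpen_compl

/-- The strict annulus crossing event is measurable. [folklore] -/
theorem measurableSet_strictAnnulusCrossing (z : ℂ) (u : ℝ) :
    MeasurableSet (strictAnnulusCrossing z u) :=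
  measurableSet_exists_joinedIn (U := fun ω : Ω₂ => (𝐒 ω) ∩ (ball z (4 * u) \ closedBall z u))
    (fun _ => (isOpen_strictBlackRegion _ _).inter (isOpen_ball.sdiff isClosed_closedBall))
    (fun q r => measurableSet_closedBall_subset_strict_inter q r _) isOpen_ball
    isClosed_closedBall.isOpen_compl

/-- The locality event is measurable (a finite intersection of count events). [folklore] -/
theorem measurableSet_nucleiNear (z : ℂ) (u : ℝ) : MeasurableSet (nucleiNear z u) := by
  have : nucleiNear z u = ⋂ (p : ℤ × ℤ) (_ : IsGridIndex p),
      ({ω : Ω₂ | (ω.1 : PointConfig ℂ).count (ball (gridPt z u p) (u / 8)) ≠ 0} ∩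
        {ω : Ω₂ | (ω.2 : PointConfig ℂ).count (ball (gridPt z u p) (u / 8)) ≠ 0}) := by
    ext ω; simp only [nucleiNear, mem_setOf_eq, mem_iInter, mem_inter_iff]
  rw [this]
  refine MeasurableSet.iInter fun p => MeasurableSet.iInter fun _ => MeasurableSet.inter ?_ ?_
  · exact ((PointConfig.measurable_count measurableSet_ball).comp measurable_fst)
      (MeasurableSpace.measurableSet_top : MeasurableSet {x : ℕ∞ | x ≠ 0})
  · exact ((PointConfig.measurable_count measurableSet_ball).comp measurable_snd)
      (MeasurableSpace.measurableSet_top : MeasurableSet {x : ℕ∞ | x ≠ 0})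

/-! #### An arm crosses every intermediate annulus -/

/-- **A strict arm from `B(z, s)` to `{|w - z| > t}` crosses the annulus of every scale `u` with
`s ≤ u` and `4u ≤ t`** (sub-continuum of the path between the levels `9u/8` and `31u/8` of
`dist · z`, `exists_subcontinuum_between_levels`; open sets are joined through continua).
[cite: Tassion2016, §4] -/
theorem strictArm_subset_strictAnnulusCrossing {z : ℂ} {s t u : ℝ} (hu : 0 < u) (hsu : s ≤ u)
    (hut : 4 * u ≤ t) : strictArm z s t ⊆ strictAnnulusCrossing z u := by
  rintro ω ⟨a, ha, b, hb, hJ⟩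
  rw [mem_ball] at ha
  rw [mem_compl_iff, mem_closedBall, not_le] at hb
  set γ : Path a b := hJ.somePath
  have hγ : ∀ τ, γ τ ∈ 𝐒 ω := hJ.somePath_mem
  have hK : IsCompact (range γ) := isCompact_range γ.continuous
  have hKc : IsPreconnected (range γ) := (isPreconnected_range γ.continuous)
  obtain ⟨K', hK'sub, hK'c, hK'pc, hK'lev, ⟨p, hp, hpl⟩, ⟨q, hq, hql⟩⟩ :=
    exists_subcontinuum_between_levels (φ := fun w => dist w z) (continuous_id.dist continuous_const)
      (a := 9 / 8 * u) (b := 31 / 8 * u) (by linarith) hK hKc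
      ⟨a, ⟨0, γ.source⟩, by linarith⟩ ⟨b, ⟨1, γ.target⟩, by linarith⟩
  set U : Set ℂ := (𝐒 ω) ∩ (ball z (4 * u) \ closedBall z u) with hU
  have hUo : IsOpen U := (isOpen_strictBlackRegion _ _).inter (isOpen_ball.sdiff isClosed_closedBall)
  have hK'U : K' ⊆ U := by
    intro w hw
    obtain ⟨τ, rfl⟩ := hK'sub hw
    have h := hK'lev _ hw
    refine ⟨hγ τ, ?_, ?_⟩
    · rw [mem_ball]; linarith [h.2]
    · rw [mem_closedBall, not_le]; linarith [h.1]
  refine ⟨p, ?_, q, ?_, joinedIn_of_isPreconnected hUo hK'pc hK'U hp hq⟩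
  · rw [mem_ball]; linarith
  · rw [mem_compl_iff, mem_closedBall, not_le]; linarith

/-! #### Locality: on `nucleiNear`, the scale-`u` colours are decided inside `localityRegion` -/

/-- `|p|² = p₁² + p₂²` for integer points. [folklore] -/
theorem norm_intPt_sq (p : ℤ × ℤ) : ‖intPt p‖ ^ 2 = ((p.1 ^ 2 + p.2 ^ 2 : ℤ) : ℝ) := by
  rw [Complex.sq_norm, intPt, Complex.normSq_mk]; push_cast; ring

/-- Grid indices have `5 < |p| < 35`. [folklore] -/
theorem norm_intPt_bounds {p : ℤ × ℤ} (hp : IsGridIndex p) : 5 < ‖intPt p‖ ∧ ‖intPt p‖ < 35 := by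
  have hsq := norm_intPt_sq p
  have h1 : (25 : ℝ) < ‖intPt p‖ ^ 2 := by rw [hsq]; exact_mod_cast hp.1
  have h2 : ‖intPt p‖ ^ 2 < (1225 : ℝ) := by rw [hsq]; exact_mod_cast hp.2
  constructor
  · nlinarith [norm_nonneg (intPt p)]
  · nlinarith [norm_nonneg (intPt p)]

/-- Distance from a grid point to the centre. [folklore] -/
theorem dist_gridPt (z : ℂ) (u : ℝ) (hu : 0 ≤ u) (p : ℤ × ℤ) :
    dist (gridPt z u p) z = u / 8 * ‖intPt p‖ := by
  rw [gridPt, dist_eq_norm, add_sub_cancel_left, norm_mul, Complex.norm_real,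
    Real.norm_of_nonneg (by positivity)]

/-- The balls of the locality event lie inside the locality region. [folklore] -/
theorem ball_gridPt_subset_localityRegion {z : ℂ} {u : ℝ} (hu : 0 < u) {p : ℤ × ℤ}
    (hp : IsGridIndex p) : ball (gridPt z u p) (u / 8) ⊆ localityRegion z u := by
  intro x hx
  rw [mem_ball] at hx
  obtain ⟨h5, h35⟩ := norm_intPt_bounds hp
  have hd := dist_gridPt z u hu.le p
  constructor
  · rw [mem_ball]
    calc dist x z ≤ dist x (gridPt z u p) + dist (gridPt z u p) z := dist_triangle _ _ _
      _ < u / 8 + u / 8 * 35 := by rw [hd]; gcongr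
      _ = 9 / 2 * u := by ring
  · rw [mem_closedBall, not_le]
    have := dist_triangle (gridPt z u p) x z
    rw [dist_comm (gridPt z u p) x] at this
    have h6 : u / 8 * 5 < dist (gridPt z u p) z := by rw [hd]; gcongr
    linarith

/-- **Covering**: every point of the closed annulus `u ≤ |w - z| ≤ 4u` is within `u/8` of a grid
point (round the coordinates of `8(w - z)/u`). [folklore] -/
theorem exists_gridPt_near {z w : ℂ} {u : ℝ} (hu : 0 < u) (h1 : u ≤ dist w z) (h2 : dist w z ≤ 4 * u) :
    ∃ p, IsGridIndex p ∧ dist w (gridPt z u p) < u / 8 := by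
  set v : ℂ := ((8 / u : ℝ) : ℂ) * (w - z) with hv
  set p : ℤ × ℤ := (round v.re, round v.im) with hpdef
  have hwz : w - z = ((u / 8 : ℝ) : ℂ) * v := by
    rw [hv, ← mul_assoc, ← Complex.ofReal_mul, show u / 8 * (8 / u) = 1 by field_simp,
      Complex.ofReal_one, one_mul]
  have hvnorm : ‖v‖ = 8 / u * dist w z := by
    rw [hv, norm_mul, Complex.norm_real, Real.norm_of_nonneg (by positivity), dist_eq_norm]
  have hv8 : 8 ≤ ‖v‖ := by
    rw [hvnorm]
    calc (8 : ℝ) = 8 / u * u := by field_simp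
      _ ≤ 8 / u * dist w z := by gcongr
  have hv32 : ‖v‖ ≤ 32 := by
    rw [hvnorm]
    calc 8 / u * dist w z ≤ 8 / u * (4 * u) := by gcongr
      _ = 32 := by field_simp; ring
  -- the rounding error
  have herr : ‖v - intPt p‖ < 1 := by
    have hre : |(v - intPt p).re| ≤ 1 / 2 := by
      simp only [Complex.sub_re, intPt, hpdef]; exact abs_sub_round v.re
    have him : |(v - intPt p).im| ≤ 1 / 2 := by
      simp only [Complex.sub_im, intPt, hpdef]; exact abs_sub_round v.im
    have hsq : ‖v - intPt p‖ ^ 2 < 1 := by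
      rw [Complex.sq_norm, Complex.normSq_apply]
      have h1 := sq_abs (v - intPt p).re
      have h2 := sq_abs (v - intPt p).im
      nlinarith [abs_nonneg (v - intPt p).re, abs_nonneg (v - intPt p).im]
    nlinarith [norm_nonneg (v - intPt p)]
  have hdist : dist w (gridPt z u p) < u / 8 := by
    rw [dist_eq_norm, gridPt, show w - (z + ((u / 8 : ℝ) : ℂ) * intPt p) =
      ((u / 8 : ℝ) : ℂ) * (v - intPt p) by rw [mul_sub, ← hwz]; ring, norm_mul, Complex.norm_real,
      Real.norm_of_nonneg (by positivity)]
    calc u / 8 * ‖v - intPt p‖ < u / 8 * 1 := by gcongr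
      _ = u / 8 := mul_one _
  refine ⟨p, ?_, hdist⟩
  -- `7 < |p| < 33`
  have hlow : 7 < ‖intPt p‖ := by
    have := norm_sub_norm_le v (v - intPt p)
    rw [sub_sub_cancel] at this
    linarith
  have hupp : ‖intPt p‖ < 33 := by
    have := norm_le_insert' v (intPt p)
    have h' : ‖intPt p‖ ≤ ‖v‖ + ‖v - intPt p‖ := by
      calc ‖intPt p‖ = ‖v - (v - intPt p)‖ := by rw [sub_sub_cancel]
        _ ≤ ‖v‖ + ‖v - intPt p‖ := norm_sub_le _ _
    linarith
  have hsq := norm_intPt_sq p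
  have h49 : (25 : ℝ) < ((p.1 ^ 2 + p.2 ^ 2 : ℤ) : ℝ) := by rw [← hsq]; nlinarith
  have h1089 : ((p.1 ^ 2 + p.2 ^ 2 : ℤ) : ℝ) < 1225 := by rw [← hsq]; nlinarith [norm_nonneg (intPt p)]
  exact ⟨by exact_mod_cast h49, by exact_mod_cast h1089⟩

/-- Distances to a set are decided by its trace on a neighbourhood of a near point: if `A` has a
point in `ball w ρ ⊆ D`, then `infDist w A = infDist w (A ∩ D)`. [folklore] -/
theorem infDist_eq_infDist_inter {A D : Set ℂ} {w : ℂ} {ρ : ℝ} (hD : ball w ρ ⊆ D)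
    (hA : (A ∩ ball w ρ).Nonempty) : infDist w A = infDist w (A ∩ D) := by
  obtain ⟨x₀, hx₀A, hx₀⟩ := hA
  have hx₀D : x₀ ∈ A ∩ D := ⟨hx₀A, hD hx₀⟩
  refine le_antisymm (infDist_le_infDist_of_subset inter_subset_left ⟨x₀, hx₀D⟩) ?_
  by_contra hlt
  rw [not_le, infDist_lt_iff ⟨x₀, hx₀A⟩] at hlt
  obtain ⟨y, hyA, hy⟩ := hlt
  by_cases hyb : y ∈ ball w ρ
  · have h1 : infDist w (A ∩ D) ≤ dist w y := infDist_le_dist_of_mem ⟨hyA, hD hyb⟩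
    exact lt_irrefl _ (h1.trans_lt hy)
  · rw [mem_ball, dist_comm, not_lt] at hyb
    rw [mem_ball, dist_comm] at hx₀
    have := infDist_le_dist_of_mem (x := w) hx₀D
    linarith

/-- **Locality of the colours (Tassion 2016, Lemma 1.1).**  On `nucleiNear z u`, at every point
`w` of the open annulus `u < |w - z| < 4u` the distances to the black and to the white nuclei
are those to the nuclei inside `localityRegion z u`; hence the strictly black region agrees there
with that of the restricted configuration. [cite: Tassion2016, Lemma 1.1] -/
theorem strictBlackRegion_inter_eq_of_mem_nucleiNear {z : ℂ} {u : ℝ} (hu : 0 < u) {ω : Ω₂}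
    (hω : ω ∈ nucleiNear z u) :
    (𝐒 ω) ∩ (ball z (4 * u) \ closedBall z u) =
      (𝐒 (restrictPair (localityRegion z u) ω)) ∩ (ball z (4 * u) \ closedBall z u) := by
  ext w
  simp only [mem_inter_iff, Set.mem_sdiff, mem_ball, mem_closedBall, not_le, mem_strictBlackRegion,
    restrictPair, coe_restrict]
  constructor <;> rintro ⟨h, h1, h2⟩ <;> refine ⟨?_, h1, h2⟩
  all_goals
    obtain ⟨p, hp, hpw⟩ := exists_gridPt_near hu h2.le h1.le
    have hballD : ball w (u / 4) ⊆ localityRegion z u := by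
      intro x hx
      rw [mem_ball] at hx
      constructor
      · rw [mem_ball]; linarith [dist_triangle x w z]
      · rw [mem_closedBall, not_le]
        have := dist_triangle w x z
        rw [dist_comm w x] at this
        linarith
    have hsub : ball (gridPt z u p) (u / 8) ⊆ ball w (u / 4) := by
      intro x hx
      rw [mem_ball] at hx ⊢
      rw [dist_comm] at hpw
      linarith [dist_triangle x (gridPt z u p) w]
    obtain ⟨hB, hW⟩ := hω p hp
    rw [PointConfig.count_ne_zero_iff] at hB hW
    have hB' : (((ω.1 : PointConfig ℂ) : Set ℂ) ∩ ball w (u / 4)).Nonempty :=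
      hB.mono (inter_subset_inter_right _ hsub)
    have hW' : (((ω.2 : PointConfig ℂ) : Set ℂ) ∩ ball w (u / 4)).Nonempty :=
      hW.mono (inter_subset_inter_right _ hsub)
    have eB := infDist_eq_infDist_inter hballD hB'
    have eW := infDist_eq_infDist_inter hballD hW'
  · rwa [← eB, ← eW]
  · rwa [eB, eW]

/-- On `nucleiNear z u`, the strict annulus crossing at scale `u` is an event of the restricted
configuration. [cite: Tassion2016, Lemma 1.1] -/
theorem mem_strictAnnulusCrossing_iff_restrictPair {z : ℂ} {u : ℝ} (hu : 0 < u) {ω : Ω₂}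
    (hω : ω ∈ nucleiNear z u) :
    ω ∈ strictAnnulusCrossing z u ↔ restrictPair (localityRegion z u) ω ∈ strictAnnulusCrossing z u := by
  simp only [strictAnnulusCrossing, mem_setOf_eq]
  rw [strictBlackRegion_inter_eq_of_mem_nucleiNear hu hω]

/-- The locality event itself only depends on the restricted configuration. [folklore] -/
theorem mem_nucleiNear_iff_restrictPair {z : ℂ} {u : ℝ} (hu : 0 < u) (ω : Ω₂) :
    ω ∈ nucleiNear z u ↔ restrictPair (localityRegion z u) ω ∈ nucleiNear z u := by
  simp only [nucleiNear, mem_setOf_eq, restrictPair, PointConfig.count_restrict]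
  refine forall₂_congr fun p hp => ?_
  rw [inter_eq_self_of_subset_right (ball_gridPt_subset_localityRegion hu hp)]

/-- The **scale-`u` event fed to independence**: "strict annulus crossing, or the locality event
fails".  It contains the crossing event and is determined by the restricted configuration. [folklore] -/
def scaleEvent (z : ℂ) (u : ℝ) : Set Ω₂ :=
  (strictAnnulusCrossing z u ∩ nucleiNear z u) ∪ (nucleiNear z u)ᶜ

/-- The scale event contains the crossing event. [folklore] -/
theorem strictAnnulusCrossing_subset_scaleEvent (z : ℂ) (u : ℝ) :
    strictAnnulusCrossing z u ⊆ scaleEvent z u := fun ω hω => by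
  by_cases h : ω ∈ nucleiNear z u
  · exact Or.inl ⟨hω, h⟩
  · exact Or.inr h

/-- The scale event is measurable. [folklore] -/
theorem measurableSet_scaleEvent (z : ℂ) (u : ℝ) : MeasurableSet (scaleEvent z u) :=
  ((measurableSet_strictAnnulusCrossing z u).inter (measurableSet_nucleiNear z u)).union
    (measurableSet_nucleiNear z u).compl

/-- The scale event is determined by the configuration restricted to the locality region.
[cite: Tassion2016, Lemma 1.1] -/
theorem preimage_restrictPair_scaleEvent {z : ℂ} {u : ℝ} (hu : 0 < u) :
    restrictPair (localityRegion z u) ⁻¹' scaleEvent z u = scaleEvent z u := by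
  ext ω
  simp only [scaleEvent, mem_preimage, mem_union, mem_inter_iff, mem_compl_iff]
  rw [← mem_nucleiNear_iff_restrictPair hu ω]
  by_cases h : ω ∈ nucleiNear z u
  · rw [← mem_strictAnnulusCrossing_iff_restrictPair hu h]
  · simp [h]

end Events

/-! ### Probability: void bounds, independence of restrictions, the multi-scale product -/

section Probability

variable {PB PW : Measure (PointConfig ℂ)}

/-- Under `PB ⊗ PW`, the probability that the black nuclei miss a set `s` of finite volume is
`e^{-vol(s)}` (void probability of the first marginal). [cite: Kingman1993, §2.1] -/
theorem measure_fst_count_eq_zero (hB : IsPoissonPointProcess (volume : Measure ℂ) PB)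
    (hW : IsPoissonPointProcess (volume : Measure ℂ) PW) {s : Set ℂ} (hs : MeasurableSet s)
    (hfin : volume s ≠ ∞) :
    (PB.prod PW) {ω : Ω₂ | (ω.1 : PointConfig ℂ).count s = 0} =
      ENNReal.ofReal (Real.exp (-(volume s).toReal)) := by
  haveI := hB.isProbabilityMeasure; haveI := hW.isProbabilityMeasure
  have : {ω : Ω₂ | (ω.1 : PointConfig ℂ).count s = 0} =
      {c : PointConfig ℂ | c.count s = 0} ×ˢ (univ : Set (PointConfig ℂ)) := by
    ext ω; simp
  rw [this, Measure.prod_prod, measure_univ, mul_one, hB.measure_count_eq_zero hs hfin]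

/-- Same for the white nuclei (second marginal). [cite: Kingman1993, §2.1] -/
theorem measure_snd_count_eq_zero (hB : IsPoissonPointProcess (volume : Measure ℂ) PB)
    (hW : IsPoissonPointProcess (volume : Measure ℂ) PW) {s : Set ℂ} (hs : MeasurableSet s)
    (hfin : volume s ≠ ∞) :
    (PB.prod PW) {ω : Ω₂ | (ω.2 : PointConfig ℂ).count s = 0} =
      ENNReal.ofReal (Real.exp (-(volume s).toReal)) := by
  haveI := hB.isProbabilityMeasure; haveI := hW.isProbabilityMeasure
  have : {ω : Ω₂ | (ω.2 : PointConfig ℂ).count s = 0} =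
      (univ : Set (PointConfig ℂ)) ×ˢ {c : PointConfig ℂ | c.count s = 0} := by
    ext ω; simp
  rw [this, Measure.prod_prod, measure_univ, one_mul, hW.measure_count_eq_zero hs hfin]

/-- Area of a disc: `vol(B(g, r)) = π r²`. [folklore] -/
theorem volume_ball_toReal (g : ℂ) {r : ℝ} (hr : 0 ≤ r) : (volume (ball g r)).toReal = r ^ 2 * Real.pi := by
  rw [Complex.volume_ball, ENNReal.toReal_mul, ENNReal.toReal_pow, ENNReal.toReal_ofReal hr,
    ENNReal.coe_toReal, NNReal.coe_real_pi]

/-- Discs have finite area. [folklore] -/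
theorem volume_ball_ne_top' (g : ℂ) (r : ℝ) : volume (ball g r) ≠ ∞ := by
  rw [Complex.volume_ball]
  exact ENNReal.mul_ne_top (ENNReal.pow_ne_top ENNReal.ofReal_ne_top) ENNReal.coe_ne_top

/-- **Void bound for the locality event** (Tassion 2016, proof of Lemma 1.1: "`P[𝓕_s] ≥
1 - C e^{-π s²/4}`"): `P[(nucleiNear z u)ᶜ] ≤ N · 2 e^{-π (u/8)²}`, `N` the number of grid
indices, uniformly in the centre `z`. [cite: Tassion2016, Lemma 1.1] -/
theorem measureReal_compl_nucleiNear_le (hB : IsPoissonPointProcess (volume : Measure ℂ) PB)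
    (hW : IsPoissonPointProcess (volume : Measure ℂ) PW) (z : ℂ) {u : ℝ} (hu : 0 ≤ u) :
    (PB.prod PW).real (nucleiNear z u)ᶜ ≤
      finite_setOf_isGridIndex.toFinset.card * (2 * Real.exp (-((u / 8) ^ 2 * Real.pi))) := by
  haveI := hB.isProbabilityMeasure; haveI := hW.isProbabilityMeasure
  set T := finite_setOf_isGridIndex.toFinset with hT
  set bad : ℤ × ℤ → Set Ω₂ := fun p =>
    {ω : Ω₂ | (ω.1 : PointConfig ℂ).count (ball (gridPt z u p) (u / 8)) = 0} ∪
      {ω : Ω₂ | (ω.2 : PointConfig ℂ).count (ball (gridPt z u p) (u / 8)) = 0} with hbad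
  have hsub : (nucleiNear z u)ᶜ ⊆ ⋃ p ∈ T, bad p := by
    intro ω hω
    simp only [nucleiNear, mem_compl_iff, mem_setOf_eq, not_forall, not_and_or, not_not] at hω
    obtain ⟨p, hp, h⟩ := hω
    simp only [mem_iUnion, hT, Set.Finite.mem_toFinset, mem_setOf_eq]
    exact ⟨p, hp, by rcases h with h | h <;> [exact Or.inl h; exact Or.inr h]⟩
  have hexp : ∀ p, (PB.prod PW).real (bad p) ≤ 2 * Real.exp (-((u / 8) ^ 2 * Real.pi)) := by
    intro p
    have h1 : (PB.prod PW).real {ω : Ω₂ | (ω.1 : PointConfig ℂ).count (ball (gridPt z u p) (u / 8)) = 0}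
        = Real.exp (-((u / 8) ^ 2 * Real.pi)) := by
      rw [measureReal_def, measure_fst_count_eq_zero hB hW measurableSet_ball (volume_ball_ne_top' _ _),
        ENNReal.toReal_ofReal (Real.exp_nonneg _), volume_ball_toReal _ (by positivity)]
    have h2 : (PB.prod PW).real {ω : Ω₂ | (ω.2 : PointConfig ℂ).count (ball (gridPt z u p) (u / 8)) = 0}
        = Real.exp (-((u / 8) ^ 2 * Real.pi)) := by
      rw [measureReal_def, measure_snd_count_eq_zero hB hW measurableSet_ball (volume_ball_ne_top' _ _),
        ENNReal.toReal_ofReal (Real.exp_nonneg _), volume_ball_toReal _ (by positivity)]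
    calc (PB.prod PW).real (bad p) ≤ _ + _ := measureReal_union_le _ _
      _ = 2 * Real.exp (-((u / 8) ^ 2 * Real.pi)) := by rw [h1, h2]; ring
  calc (PB.prod PW).real (nucleiNear z u)ᶜ ≤ (PB.prod PW).real (⋃ p ∈ T, bad p) :=
        measureReal_mono hsub (measure_ne_top _ _)
    _ ≤ ∑ p ∈ T, (PB.prod PW).real (bad p) := measureReal_biUnion_finset_le _ _
    _ ≤ ∑ p ∈ T, 2 * Real.exp (-((u / 8) ^ 2 * Real.pi)) := Finset.sum_le_sum fun p _ => hexp p
    _ = T.card * (2 * Real.exp (-((u / 8) ^ 2 * Real.pi))) := by rw [Finset.sum_const, nsmul_eq_mul]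

/-- **`P[𝓕ᶜ] → 0` uniformly in the centre**: for `ε > 0` there is a scale `U` beyond which the
locality event fails with probability at most `ε`, whatever the centre. [cite: Tassion2016, Lemma 1.1] -/
theorem exists_forall_measureReal_compl_nucleiNear_le
    (hB : IsPoissonPointProcess (volume : Measure ℂ) PB)
    (hW : IsPoissonPointProcess (volume : Measure ℂ) PW) {ε : ℝ} (hε : 0 < ε) :
    ∃ U : ℝ, 0 < U ∧ ∀ u, U ≤ u → ∀ z, (PB.prod PW).real (nucleiNear z u)ᶜ ≤ ε := by
  set N : ℝ := (finite_setOf_isGridIndex.toFinset.card : ℝ) with hN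
  have hlim : Tendsto (fun u : ℝ => N * (2 * Real.exp (-((u / 8) ^ 2 * Real.pi)))) atTop (𝓝 0) := by
    have h1 : Tendsto (fun u : ℝ => (u / 8) ^ 2 * Real.pi) atTop atTop :=
      ((tendsto_pow_atTop two_ne_zero).comp (tendsto_id.atTop_div_const (by norm_num))).atTop_mul_const
        Real.pi_pos
    have h2 : Tendsto (fun u : ℝ => Real.exp (-((u / 8) ^ 2 * Real.pi))) atTop (𝓝 0) :=
      Real.tendsto_exp_atBot.comp (tendsto_neg_atTop_atBot.comp h1)
    simpa using (h2.const_mul 2).const_mul N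
  obtain ⟨U₀, hU₀⟩ := Filter.eventually_atTop.1 (hlim.eventually (gt_mem_nhds hε))
  refine ⟨max U₀ 1, by positivity, fun u hu z => ?_⟩
  have hu0 : 0 ≤ u := le_trans (by positivity) hu
  exact (measureReal_compl_nucleiNear_le hB hW z hu0).trans (hU₀ u (le_trans (le_max_left _ _) hu)).le

/-! #### Independence of the restrictions of both colours to disjoint regions -/

/-- One colour: the product formula of the restriction theorem along a finite set of indices
`q = ⟨i, b⟩` with constant colour `b` (reindexing by `i`). [cite: Kingman1993, §2.2] -/
theorem measure_biInter_restrict_preimage_eq_prod {ν : Measure ℂ} {P : Measure (PointConfig ℂ)}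
    (hP : IsPoissonPointProcess ν P) {n : ℕ} {D : Fin n → Set ℂ} (hD : ∀ i, MeasurableSet (D i))
    (hdisj : Pairwise (Function.onFun Disjoint D)) (S : Finset (Σ _ : Fin n, Bool)) (b : Bool)
    (hS : ∀ q ∈ S, q.2 = b) {A : (Σ _ : Fin n, Bool) → Set (PointConfig ℂ)}
    (hA : ∀ q ∈ S, MeasurableSet (A q)) :
    P (⋂ q ∈ S, PointConfig.restrict (D q.1) ⁻¹' A q) =
      ∏ q ∈ S, P (PointConfig.restrict (D q.1) ⁻¹' A q) := by
  classical
  have hq_eq : ∀ q ∈ S, q = ⟨q.1, b⟩ := fun q hq => by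
    obtain ⟨i, b'⟩ := q
    have h2 : b' = b := hS _ hq
    subst h2; rfl
  have hinj : Set.InjOn (Sigma.fst : (Σ _ : Fin n, Bool) → Fin n) S := by
    intro q hq q' hq' h
    rw [hq_eq q hq, hq_eq q' hq']
    exact Sigma.ext h (heq_of_eq rfl)
  have h1 : (⋂ q ∈ S, PointConfig.restrict (D q.1) ⁻¹' A q) =
      ⋂ i ∈ S.image Sigma.fst, PointConfig.restrict (D i) ⁻¹' A ⟨i, b⟩ := by
    rw [Finset.set_biInter_finset_image]
    refine iInter₂_congr fun q hq => ?_
    conv_lhs => rw [hq_eq q hq]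
  have h2 : (∏ q ∈ S, P (PointConfig.restrict (D q.1) ⁻¹' A q)) =
      ∏ i ∈ S.image Sigma.fst, P (PointConfig.restrict (D i) ⁻¹' A ⟨i, b⟩) := by
    rw [Finset.prod_image hinj]
    refine Finset.prod_congr rfl fun q hq => ?_
    conv_lhs => rw [hq_eq q hq]
  rw [h1, h2]
  refine (hP.iIndepFun_restrict hD hdisj).measure_inter_preimage_eq_mul _ fun i hi => ?_
  obtain ⟨q, hq, rfl⟩ := Finset.mem_image.1 hi
  rw [← hq_eq q hq]
  exact hA q hq

/-- **The flattened family of one-colour restrictions is independent under `PB ⊗ PW`**: the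
maps `ω ↦ ω.b ∩ D i`, `(i, b) ∈ Fin n × {black, white}`, for pairwise disjoint measurable `D i`
(restriction theorem for each colour, and independence of the two colours). [cite: Kingman1993, §2.2] -/
theorem iIndepFun_restrict_sigma {ν ν' : Measure ℂ} (hB : IsPoissonPointProcess ν PB)
    (hW : IsPoissonPointProcess ν' PW) {n : ℕ} {D : Fin n → Set ℂ} (hD : ∀ i, MeasurableSet (D i))
    (hdisj : Pairwise (Function.onFun Disjoint D)) :
    iIndepFun (fun (q : Σ _ : Fin n, Bool) (ω : Ω₂) =>
      PointConfig.restrict (D q.1) (bif q.2 then ω.2 else ω.1 : PointConfig ℂ)) (PB.prod PW) := by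
  classical
  haveI := hB.isProbabilityMeasure; haveI := hW.isProbabilityMeasure
  rw [iIndepFun_iff_measure_inter_preimage_eq_mul]
  intro S A hA
  set S₀ := S.filter (fun q => q.2 = false) with hS₀
  set S₁ := S.filter (fun q => ¬ q.2 = false) with hS₁
  have hS₀b : ∀ q ∈ S₀, q.2 = false := fun q hq => (Finset.mem_filter.1 hq).2
  have hS₁b : ∀ q ∈ S₁, q.2 = true := fun q hq => by
    have := (Finset.mem_filter.1 hq).2; simpa using this
  have hA₀ : ∀ q ∈ S₀, MeasurableSet (A q) := fun q hq => hA q (Finset.mem_filter.1 hq).1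
  have hA₁ : ∀ q ∈ S₁, MeasurableSet (A q) := fun q hq => hA q (Finset.mem_filter.1 hq).1
  -- the intersection is a rectangle
  have hrect : (⋂ q ∈ S, (fun ω : Ω₂ => PointConfig.restrict (D q.1)
        (bif q.2 then ω.2 else ω.1 : PointConfig ℂ)) ⁻¹' A q) =
      (⋂ q ∈ S₀, PointConfig.restrict (D q.1) ⁻¹' A q) ×ˢ
        (⋂ q ∈ S₁, PointConfig.restrict (D q.1) ⁻¹' A q) := by
    ext ω
    simp only [mem_iInter, mem_preimage, mem_prod, hS₀, hS₁, Finset.mem_filter]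
    constructor
    · intro h
      refine ⟨fun q hq => ?_, fun q hq => ?_⟩
      · have := h q hq.1; rw [hq.2] at this; exact this
      · have h2 : q.2 = true := by simpa using hq.2
        have := h q hq.1; rw [h2] at this; exact this
    · rintro ⟨h0, h1⟩ q hq
      cases h2 : q.2 with
      | false => exact h0 q ⟨hq, h2⟩
      | true => exact h1 q ⟨hq, by simp [h2]⟩
  -- each single preimage is a rectangle with one trivial side
  have hsingle₀ : ∀ q ∈ S₀, (PB.prod PW) ((fun ω : Ω₂ => PointConfig.restrict (D q.1)
        (bif q.2 then ω.2 else ω.1 : PointConfig ℂ)) ⁻¹' A q) =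
      PB (PointConfig.restrict (D q.1) ⁻¹' A q) := by
    intro q hq
    have : ((fun ω : Ω₂ => PointConfig.restrict (D q.1) (bif q.2 then ω.2 else ω.1 : PointConfig ℂ))
        ⁻¹' A q) = (PointConfig.restrict (D q.1) ⁻¹' A q) ×ˢ (univ : Set (PointConfig ℂ)) := by
      ext ω; simp [hS₀b q hq]
    rw [this, Measure.prod_prod, measure_univ, mul_one]
  have hsingle₁ : ∀ q ∈ S₁, (PB.prod PW) ((fun ω : Ω₂ => PointConfig.restrict (D q.1)
        (bif q.2 then ω.2 else ω.1 : PointConfig ℂ)) ⁻¹' A q) =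
      PW (PointConfig.restrict (D q.1) ⁻¹' A q) := by
    intro q hq
    have : ((fun ω : Ω₂ => PointConfig.restrict (D q.1) (bif q.2 then ω.2 else ω.1 : PointConfig ℂ))
        ⁻¹' A q) = (univ : Set (PointConfig ℂ)) ×ˢ (PointConfig.restrict (D q.1) ⁻¹' A q) := by
      ext ω; simp [hS₁b q hq]
    rw [this, Measure.prod_prod, measure_univ, one_mul]
  rw [hrect, Measure.prod_prod, measure_biInter_restrict_preimage_eq_prod hB hD hdisj S₀ false hS₀b hA₀,
    measure_biInter_restrict_preimage_eq_prod hW hD hdisj S₁ true hS₁b hA₁,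
    ← Finset.prod_filter_mul_prod_filter_not S (fun q => q.2 = false)]
  congr 1
  · exact (Finset.prod_congr rfl hsingle₀).symm
  · exact (Finset.prod_congr rfl hsingle₁).symm

/-- **Product formula for events of the restricted pairs** (Tassion's "these events are
independent", §3–§4): for pairwise disjoint measurable regions `D i` and measurable events
`M i` of the pair of configurations, the events "`(ω.B ∩ D i, ω.W ∩ D i) ∈ M i`" are
independent under `PB ⊗ PW`. [cite: Tassion2016, §4] -/
theorem measure_iInter_restrictPair_preimage {ν ν' : Measure ℂ} (hB : IsPoissonPointProcess ν PB)
    (hW : IsPoissonPointProcess ν' PW) {n : ℕ} {D : Fin n → Set ℂ} (hD : ∀ i, MeasurableSet (D i))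
    (hdisj : Pairwise (Function.onFun Disjoint D)) {M : Fin n → Set Ω₂} (hM : ∀ i, MeasurableSet (M i)) :
    (PB.prod PW) (⋂ i, restrictPair (D i) ⁻¹' M i) = ∏ i, (PB.prod PW) (restrictPair (D i) ⁻¹' M i) := by
  have hmeas : ∀ (i : Fin n) (b : Bool), Measurable fun ω : Ω₂ =>
      PointConfig.restrict (D i) (bif b then ω.2 else ω.1 : PointConfig ℂ) := by
    intro i b
    cases b
    · exact (PointConfig.measurable_restrict (hD i)).comp measurable_fst
    · exact (PointConfig.measurable_restrict (hD i)).comp measurable_snd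
  have h := iIndepFun_pi_of_sigma (μ := PB.prod PW) (κ := fun _ : Fin n => Bool)
    (f := fun i b (ω : Ω₂) => PointConfig.restrict (D i) (bif b then ω.2 else ω.1 : PointConfig ℂ))
    hmeas (iIndepFun_restrict_sigma hB hW hD hdisj)
  have hv : ∀ i, MeasurableSet {v : Bool → PointConfig ℂ | (v false, v true) ∈ M i} := fun i =>
    ((measurable_pi_apply false).prodMk (measurable_pi_apply true)) (hM i)
  have := h.measure_inter_preimage_eq_mul Finset.univ
    (sets := fun i => {v : Bool → PointConfig ℂ | (v false, v true) ∈ M i}) fun i _ => hv i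
  simp only [Finset.mem_univ, iInter_true] at this
  exact this

/-! #### Tassion's multi-scale argument -/

/-- The locality regions of the scales `u · 9^i` are pairwise disjoint. [folklore] -/
theorem pairwise_disjoint_localityRegion (z : ℂ) {u : ℝ} (hu : 0 < u) (n : ℕ) :
    Pairwise (Function.onFun Disjoint fun i : Fin n => localityRegion z (u * 9 ^ (i : ℕ))) := by
  -- for `i < j`, `9/2 · u 9^i ≤ 1/2 · u 9^j`
  have key : ∀ i j : Fin n, (i : ℕ) < (j : ℕ) →
      Disjoint (localityRegion z (u * 9 ^ (i : ℕ))) (localityRegion z (u * 9 ^ (j : ℕ))) := by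
    intro i j hij
    rw [Set.disjoint_left]
    rintro w ⟨hw1, -⟩ ⟨-, hw2⟩
    rw [mem_ball] at hw1
    rw [mem_closedBall, not_le] at hw2
    have h9 : (9 : ℝ) ^ (i : ℕ) * 9 ≤ 9 ^ (j : ℕ) := by
      rw [← pow_succ]; exact pow_le_pow_right₀ (by norm_num) hij
    nlinarith [pow_pos (by norm_num : (0 : ℝ) < 9) (i : ℕ)]
  intro i j hij
  rcases lt_or_gt_of_ne (Fin.val_ne_of_ne hij) with h | h
  · exact key i j h
  · exact (key j i h).symm

/-- **Strict one-arm decay from a scale-uniform annulus bound (Tassion 2016, §4).**  Let `PB`,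
`PW` be independent Poisson processes of Lebesgue intensity (black and white nuclei).  Suppose
that for some `c > 0` and all scales `u ≥ u₀` and centres `z`, the strict annulus crossing
`strictAnnulusCrossing z u` has probability at most `1 - c` (the RSW input: by duality this is a
white blocking circuit with probability `≥ c`, Tassion's Thm 1 / Thm 3 (1)).  Then there are `C`
and `η > 0` with `P[strictArm z s t] ≤ C (s/t)^η` for all `1 ≤ s ≤ t` and all `z`: the arm
crosses the annuli of the scales `u₁ s 9^i ≤ t/4`, whose events "crossing or `𝓕ᶜ`" are
independent (locality, Lemma 1.1) and each of probability `≤ 1 - c/2`.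
[cite: Tassion2016, §4 (proof of Thm 3 (2))] -/
theorem strictOneArm_decay_of_annulusBound (hB : IsPoissonPointProcess (volume : Measure ℂ) PB)
    (hW : IsPoissonPointProcess (volume : Measure ℂ) PW) {c u₀ : ℝ} (hc : 0 < c) (hu₀ : 0 < u₀)
    (hann : ∀ u, u₀ ≤ u → ∀ z, (PB.prod PW).real (strictAnnulusCrossing z u) ≤ 1 - c) :
    ∃ C η : ℝ, 0 < η ∧ ∀ s t : ℝ, 1 ≤ s → s ≤ t → ∀ z : ℂ,
      (PB.prod PW).real (strictArm z s t) ≤ C * (s / t) ^ η := by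
  haveI := hB.isProbabilityMeasure; haveI := hW.isProbabilityMeasure
  set μ := PB.prod PW with hμ
  -- `c ≤ 1`
  have hc1 : c ≤ 1 := by
    have := hann u₀ le_rfl 0
    linarith [measureReal_nonneg (μ := μ) (s := strictAnnulusCrossing 0 u₀)]
  -- the locality scale
  obtain ⟨U, hU, hUF⟩ := exists_forall_measureReal_compl_nucleiNear_le hB hW (half_pos hc)
  set u₁ : ℝ := max (max u₀ U) 1 with hu₁
  have hu₁1 : 1 ≤ u₁ := le_max_right _ _
  have hu₁0 : 0 < u₁ := by positivity
  have hu₁u₀ : u₀ ≤ u₁ := le_trans (le_max_left _ _) (le_max_left _ _)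
  have hu₁U : U ≤ u₁ := le_trans (le_max_right _ _) (le_max_left _ _)
  -- the bound at one scale
  set q : ℝ := 1 - c / 2 with hq
  have hq0 : 0 < q := by rw [hq]; linarith
  have hq1 : q < 1 := by rw [hq]; linarith
  have hscale : ∀ u, u₁ ≤ u → ∀ z, μ.real (scaleEvent z u) ≤ q := by
    intro u hu z
    calc μ.real (scaleEvent z u)
        ≤ μ.real (strictAnnulusCrossing z u ∩ nucleiNear z u) + μ.real (nucleiNear z u)ᶜ :=
          measureReal_union_le _ _
      _ ≤ μ.real (strictAnnulusCrossing z u) + μ.real (nucleiNear z u)ᶜ := by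
          gcongr
          · exact measure_ne_top _ _
          · exact inter_subset_left
      _ ≤ (1 - c) + c / 2 := add_le_add (hann u (hu₁u₀.trans hu) z) (hUF u (hu₁U.trans hu) z)
      _ = q := by rw [hq]; ring
  -- constants
  set η : ℝ := -Real.logb 9 q with hη
  have hη0 : 0 < η := by
    rw [hη, neg_pos]
    exact Real.logb_neg (by norm_num) hq0 hq1
  refine ⟨(4 * u₁) ^ η, η, hη0, fun s t hs hst z => ?_⟩
  have hs0 : 0 < s := by linarith
  have ht0 : 0 < t := by linarith
  -- number of scales
  set x : ℝ := Real.logb 9 (t / (4 * u₁ * s)) with hx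
  obtain ⟨n, hn⟩ : ∃ n : ℕ, n = ⌈x⌉₊ := ⟨_, rfl⟩
  have hx9 : (9 : ℝ) ^ x = t / (4 * u₁ * s) := by
    rw [hx, Real.rpow_logb (by norm_num) (by norm_num) (by positivity)]
  -- the scales `u i = u₁ s 9^i`, `i < n`, satisfy `s ≤ u i` and `4 u i ≤ t`
  set uu : Fin n → ℝ := fun i => u₁ * s * 9 ^ (i : ℕ) with huu
  have huu_pos : ∀ i, 0 < uu i := fun i => by positivity
  have huu_ge : ∀ i, u₁ ≤ uu i := fun i => by
    have h9 : (1 : ℝ) ≤ 9 ^ (i : ℕ) := one_le_pow₀ (by norm_num)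
    calc u₁ = u₁ * 1 * 1 := by ring
      _ ≤ u₁ * s * 9 ^ (i : ℕ) := by gcongr
  have huu_s : ∀ i, s ≤ uu i := fun i => by
    have h9 : (1 : ℝ) ≤ 9 ^ (i : ℕ) := one_le_pow₀ (by norm_num)
    calc s = 1 * s * 1 := by ring
      _ ≤ u₁ * s * 9 ^ (i : ℕ) := by gcongr
  have huu_t : ∀ i : Fin n, 4 * uu i ≤ t := fun i => by
    have hi : ((i : ℕ) : ℝ) < x := by
      have : (i : ℕ) < ⌈x⌉₊ := by rw [← hn]; exact i.2
      exact Nat.lt_ceil.1 this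
    have h9i : (9 : ℝ) ^ (i : ℕ) < 9 ^ x := by
      rw [← Real.rpow_natCast]
      exact Real.rpow_lt_rpow_of_exponent_lt (by norm_num) hi
    rw [hx9, lt_div_iff₀ (by positivity)] at h9i
    simp only [huu]
    linarith
  -- the arm lies in every scale event
  have hsub : strictArm z s t ⊆ ⋂ i : Fin n, restrictPair (localityRegion z (uu i)) ⁻¹' scaleEvent z (uu i) := by
    refine subset_iInter fun i => ?_
    rw [preimage_restrictPair_scaleEvent (huu_pos i)]
    exact (strictArm_subset_strictAnnulusCrossing (huu_pos i) (huu_s i) (huu_t i)).trans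
      (strictAnnulusCrossing_subset_scaleEvent _ _)
  -- independence
  have hdisj : Pairwise (Function.onFun Disjoint fun i : Fin n => localityRegion z (uu i)) := by
    have := pairwise_disjoint_localityRegion z (u := u₁ * s) (by positivity) n
    simpa [huu] using this
  have hprod := measure_iInter_restrictPair_preimage hB hW
    (fun i => measurableSet_localityRegion z (uu i)) hdisj (fun i => measurableSet_scaleEvent z (uu i))
  have hreal : μ.real (⋂ i : Fin n, restrictPair (localityRegion z (uu i)) ⁻¹' scaleEvent z (uu i)) ≤ q ^ n := by
    rw [measureReal_def, hμ, hprod, ENNReal.toReal_prod]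
    calc ∏ i : Fin n, ((PB.prod PW) (restrictPair (localityRegion z (uu i)) ⁻¹' scaleEvent z (uu i))).toReal
        ≤ ∏ _i : Fin n, q := by
          refine Finset.prod_le_prod (fun i _ => ENNReal.toReal_nonneg) fun i _ => ?_
          rw [preimage_restrictPair_scaleEvent (huu_pos i)]
          exact hscale (uu i) (huu_ge i) z
      _ = q ^ n := by rw [Finset.prod_const, Finset.card_univ, Fintype.card_fin]
  -- arithmetic: `q^n ≤ (4 u₁)^η (s/t)^η`
  have hqn : q ^ n ≤ (4 * u₁) ^ η * (s / t) ^ η := by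
    have hnx : x ≤ n := by rw [hn]; exact Nat.le_ceil x
    have h1 : (q : ℝ) ^ n = q ^ (n : ℝ) := (Real.rpow_natCast q n).symm
    have h2 : q ^ (n : ℝ) ≤ q ^ x := Real.rpow_le_rpow_of_exponent_ge hq0 hq1.le hnx
    have h3 : q ^ x = (4 * u₁) ^ η * (s / t) ^ η := by
      have hq9 : q = 9 ^ (Real.logb 9 q) := (Real.rpow_logb (by norm_num) (by norm_num) hq0).symm
      calc q ^ x = (9 ^ (Real.logb 9 q)) ^ x := by rw [← hq9]
        _ = (9 ^ x) ^ (Real.logb 9 q) := by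
            rw [← Real.rpow_mul (by norm_num), mul_comm, Real.rpow_mul (by norm_num)]
        _ = (t / (4 * u₁ * s)) ^ (-η) := by rw [hx9, hη, neg_neg]
        _ = ((4 * u₁ * s) / t) ^ η := by
            rw [Real.rpow_neg (by positivity), ← Real.inv_rpow (by positivity), inv_div]
        _ = ((4 * u₁) * (s / t)) ^ η := by rw [mul_div_assoc]
        _ = (4 * u₁) ^ η * (s / t) ^ η := Real.mul_rpow (by positivity) (by positivity)
    rw [h1]; exact h2.trans h3.le
  calc μ.real (strictArm z s t)
      ≤ μ.real (⋂ i : Fin n, restrictPair (localityRegion z (uu i)) ⁻¹' scaleEvent z (uu i)) :=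
        measureReal_mono hsub (measure_ne_top _ _)
    _ ≤ q ^ n := hreal
    _ ≤ (4 * u₁) ^ η * (s / t) ^ η := hqn

end Probability

end Literature.Probability.Percolation
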